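import Literature.AlgebraicGeometry.HodgeTheory.GAGADifferentialFormsProjectiveSpace
import Literature.Algebra.Homology.SerreFinitenessH0
import HarnessLib

/-!
# No twisted `p`-forms on `ℙ_r` below degree `p`: `H⁰(ℙ_r, Ω^p(k)) = 0` for `k < p`

Okonek–Schneider–Spindler, *Vector bundles on complex projective spaces*, Ch. I § 1.1, record the
values `h^q(ℙ_n, Ω^p_{ℙ_n}(k))` (BOTT'S FORMULA): for `q = 0` they are `C(k+n-p, k)·C(k-1, p)` for
`0 ≤ p ≤ n`, `k > p`, `1` for `k = 0 = p = q`, and `0` otherwise. This file proves the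
`q = 0`, `k < p` corner of the "otherwise" — **`H⁰(ℙ_r, Ω^p(k)) = 0` for every `p` and every
`k < p`** (in particular `h^{p,0}(ℙ_r) = 0` for `p ≥ 1`: projective space carries no non-zero
holomorphic `p`-forms) — for `r ≥ 1`, on BOTH sides of GAGA, in the tree's Čech language:

* `LaurentCech.eq_zero_of_forall_mem_locDeg_top_of_lt` — a vector of Laurent polynomials which is a
  section of `⊕_j 𝒪(d - e_j)` on EVERY standard chart `D₊(x_i)` of `ℙ_r`, `r ≥ 1`, with all
  `d - e_j < 0`, is zero (its monomials would have all exponents `≥ 0` and negative total degree);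
* `LaurentCech.isZero_homology_cech_zero_of_forall_lt` — hence **`H⁰(Č_d(K)) = 0`** for every
  submodule `K ⊆ F_e = ⊕_j P(-e_j)` and every `d < min_j e_j` (Hartshorne III Thm. 5.1 (a):
  `H⁰(𝒪(n)) = S_n`, `= 0` for `n < 0`; a Čech `0`-cocycle is one element of `⋂_i K_{x_i}`);
* **`GAGAForms.isZero_homology_cech_Zsub_zero_of_lt`** — `H⁰(Č_k(Z_p)) = 0` for `k < p`, where
  `Z_p = Γ_*(Ω^p_{ℙ_r}) ⊆ Λ^p P^{r+1}(-p)` is the graded module of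
  `GAGADifferentialFormsProjectiveSpace` (`GAGAForms.Zsub`), i.e. `H⁰(ℙ_r, Ω^p(k)) = 0`;
* **`GAGAForms.isZero_homology_holCech_zero_of_lt`** — the same for the holomorphic Čech complex
  `Č(𝔘^h, Ω^p(k)^h)` (`GAGAForms.holCech`), transported along Serre's GAGA comparison
  isomorphism `GAGAForms.isIso_homologyMap_cechComparison`.

The case `r = 0` (a point) is excluded as in the tree's `GAGATwist.exists_mvPolynomial_of_d_zero_eq_zero`:
on `ℙ_0` the single chart is everything and `x_0^{-1}` is a global section of `𝒪(-1)`.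
Theorems only; no definitions, no named facts.

## References
* [OkonekSchneiderSpindler1980] C. Okonek, M. Schneider, H. Spindler, *Vector bundles on complex
  projective spaces*, Progress in Math. 3 (1980), Ch. I § 1.1, Bott formula (p. 8).
* [Hartshorne1977] R. Hartshorne, *Algebraic Geometry* (1977), III Thm. 5.1 (a) (p. 225).
* [SerreGAGA1956] J.-P. Serre, *Géométrie algébrique et géométrie analytique*, Ann. Inst. Fourier
  6 (1956), n° 12 Théorème 1.
-/

noncomputable section

open CategoryTheory CategoryTheory.Limits

universe u

namespace Literature.Algebra.Homology

namespace LaurentCech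

open OrderedCech

variable {A : Type u} [CommRing A] {r : ℕ} {J : Type} (e : J → ℤ)

/-- **A section of `⊕_j 𝒪(d - e_j)` over every standard chart of `ℙ_r`, `r ≥ 1`, with all
`d - e_j < 0` is zero**: a monomial `x^m 𝟙_j` occurring in it is admissible on every chart
`D₊(x_i)`, so `m_k ≥ 0` for every `k` (use a chart `i ≠ k`), contradicting `|m| = d - e_j < 0`.
[cite: Hartshorne1977, III Thm. 5.1 (a)] -/
theorem eq_zero_of_forall_mem_locDeg_top_of_lt (hr : 1 ≤ r) [Finite J] {d : ℤ} (hd : ∀ j, d < e j)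
    {v : J → L A r}
    (hv : ∀ i : Fin (r + 1), v ∈ locDeg e (⊤ : Submodule (P A r) (J → P A r)) {i} d) : v = 0 := by
  funext j
  rw [Pi.zero_apply]
  apply AddMonoidAlgebra.ext
  rw [AddMonoidAlgebra.coeff_zero]
  ext m
  rw [Finsupp.coe_zero, Pi.zero_apply]
  by_contra hm
  have hadm : ∀ i : Fin (r + 1), m ∈ admissible ({i} : Finset (Fin (r + 1))) (d - e j) :=
    fun i => (mem_locDeg_top_iff e).mp (hv i) j m hm
  have hnonneg : ∀ k, 0 ≤ m k := by
    intro k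
    -- a chart `i ≠ k` exists since `r ≥ 1`
    obtain ⟨i, hik⟩ : ∃ i : Fin (r + 1), i ≠ k := by
      by_cases hk : k = 0
      · exact ⟨⟨1, by omega⟩, fun h => by rw [hk] at h; exact absurd (congrArg Fin.val h) (by simp)⟩
      · exact ⟨0, fun h => hk h.symm⟩
    exact ((mem_admissible).mp (hadm i)).2 k (by rwa [Finset.mem_singleton, ← ne_eq, ne_comm])
  have hdeg : edeg r m = d - e j := ((mem_admissible).mp (hadm 0)).1
  have hsum : 0 ≤ edeg r m := by
    rw [edeg_apply]
    exact Finset.sum_nonneg fun k _ => hnonneg k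
  have := hd j
  omega

variable (K : Submodule (P A r) (J → P A r))

/-- **`H⁰(Č_d(K)) = 0` below the generating degrees**: for `r ≥ 1`, any submodule
`K ⊆ F_e = ⊕_j P(-e_j)` and `d < e_j` for all `j`, the degree-`0` cohomology of the Čech complex
`Č_d(K)` vanishes — a `0`-cocycle is one vector lying in every `(K_{x_i})_d ⊆ ((F_e)_{x_i})_d`
(`OrderedCech.d_zero_eq_zero_iff`), hence zero by `eq_zero_of_forall_mem_locDeg_top_of_lt`
(Hartshorne III Thm. 5.1 (a): `H⁰(𝒪(n)) = S_n = 0` for `n < 0`).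
[cite: Hartshorne1977, III Thm. 5.1 (a)] -/
theorem isZero_homology_cech_zero_of_forall_lt (hr : 1 ≤ r) [Finite J] {d : ℤ}
    (hd : ∀ j, d < e j) : IsZero ((cech e K d).homology 0) := by
  set C := cech e K d
  rw [← HomologicalComplex.exactAt_iff_isZero_homology,
    C.exactAt_iff' (-1) 0 1 (by simp) (by simp), ShortComplex.moduleCat_exact_iff]
  intro c hc
  refine ⟨0, ?_⟩
  rw [map_zero]
  have hg : (C.sc' (-1) 0 1).g =
      ModuleCat.ofHom (OrderedCech.d (fun s => locDeg e K s d) (locDeg_mono e K d) 0) :=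
    OrderedCech.complex_d _ (locDeg_mono e K d) 0
  have hc' : OrderedCech.d (fun s => locDeg e K s d) (locDeg_mono e K d) 0 c = 0 := by
    have := hc
    rw [hg] at this
    exact this
  have heq := (OrderedCech.d_zero_eq_zero_iff (fun s => locDeg e K s d) (locDeg_mono e K d) c).1 hc'
  -- the common value of the cocycle lies in every `(K_{x_i})_d ⊆ ((F_e)_{x_i})_d`, hence is `0`
  have h0 : ((c (vertex (0 : Fin (r + 1))) : J → L A r)) = 0 := by
    apply eq_zero_of_forall_mem_locDeg_top_of_lt e hr hd
    intro i
    rw [heq 0 i]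
    exact locDeg_le_locDeg_top e K {i} d (by rw [← vertex_val i]; exact (c (vertex i)).2)
  symm
  funext σ
  obtain ⟨i, rfl⟩ := exists_eq_vertex σ
  apply Subtype.ext
  rw [heq i 0, h0]
  rfl

end LaurentCech

end Literature.Algebra.Homology

namespace Literature.AlgebraicGeometry.HodgeTheory

namespace GAGAForms

open Literature.Algebra.Homology Literature.Algebra.Homology.LaurentCech
  Literature.Algebra.Homology.KoszulCech

variable {r : ℕ}

/-- **Bott's formula, corner `q = 0`, `k < p`: `H⁰(ℙ_r, Ω^p(k)) = 0`** (algebraic side, `r ≥ 1`):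
the degree-`0` cohomology of the Čech complex `Č_k(Z_p)` of `Z_p = Γ_*(Ω^p) ⊆ Λ^p P^{r+1}(-p)`
vanishes for `k < p`, since all generators of the ambient free module sit in degree `p`. In
particular (`k = 0 < p`) `ℙ_r` has no non-zero regular `p`-forms, `h^{p,0}(ℙ_r) = 0`.
[cite: OkonekSchneiderSpindler1980, Ch. I § 1.1, Bott formula (p. 8)] -/
theorem isZero_homology_cech_Zsub_zero_of_lt (hr : 1 ≤ r) (p : ℕ) {k : ℤ} (hk : k < p) :
    IsZero ((LaurentCech.cech (fun _ : Sub (Fin (r + 1)) p => (p : ℤ)) (Zsub r p) k).homology 0) :=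
  LaurentCech.isZero_homology_cech_zero_of_forall_lt _ (Zsub r p) hr (fun _ => hk)

/-- **Bott's formula, corner `q = 0`, `k < p`, analytic side: `H⁰(𝔘^h, Ω^p(k)^h) = 0`** for
`r ≥ 1` and `k < p` — transported from `isZero_homology_cech_Zsub_zero_of_lt` along Serre's GAGA
comparison isomorphism `H⁰(Č_k(Z_p)) ≅ H⁰(Č(𝔘^h, Ω^p(k)^h))` (`isIso_homologyMap_cechComparison`).
In particular `ℙ_r(ℂ)` carries no non-zero holomorphic `p`-forms, `p ≥ 1`.
[cite: OkonekSchneiderSpindler1980, Ch. I § 1.1, Bott formula (p. 8)]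
[cite: SerreGAGA1956, n° 12 Théorème 1] -/
theorem isZero_homology_holCech_zero_of_lt (hr : 1 ≤ r) (p : ℕ) {k : ℤ} (hk : k < p) :
    IsZero ((holCech r p k).homology 0) := by
  haveI := isIso_homologyMap_cechComparison (r := r) p k 0
  exact (isZero_homology_cech_Zsub_zero_of_lt hr p hk).of_iso
    (asIso (HomologicalComplex.homologyMap (cechComparison r p k) 0)).symm

end GAGAForms

end Literature.AlgebraicGeometry.HodgeTheory

end
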